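import Summits.CriticalPhenomena.PercolationContinuityZ3.Theorems.PercNearOneGluingNoHeavyLowerTailThreePartitionDecoupled
import Summits.CriticalPhenomena.PercolationContinuityZ3.Theorems.PercNearOneGluingNoHeavyLowerTailThreePartitionVOrderDisjointSupports

/-!
# `DecoupledVOrder` holds under disjoint supports (support file)

Support file (prover seat `prim-bnk-2`, gen 29 content landed in gen 32; `--supports stmt-CriticalPhenomena-4575`).  Memo
`run/shared/lean/prim/prim-l12/FROM-prim-bnk-2-g29-DECOUPLED-HALL.md` §3.

`…ThreePartitionDecoupled` splits the kernel sum of Conjecture V into ROW units (`T3∓`) and COLUMN units (`T1∓, T2∓`), proves that columns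
are self-sufficient on column-closed families (`colNegUnits_le_colPosUnits`) and states the decoupled conjecture `DecoupledVOrder`.
`…ThreePartitionVOrderDisjointSupports` proves Conjecture V when `𝒲` depends only on the coordinates in `J` and `𝒱` only on those outside `J`
(THEOREM I), through the row move `triT_row_le_of_measurable`.  Here the two are combined: under disjoint supports the ROWS are self-sufficient
too (`rowNegUnits_le_rowPosUnits_of_measurable`), hence the inequality of `DecoupledVOrder` holds for such pairs and every twist
(`decoupledVOrder_of_disjointSupports`) — the decoupled conjecture is thus a theorem at both ends of the programme (nested pairs, in
`…ThreePartitionDecoupled`, and disjoint supports).  No definitions; no `sorry`; standard axioms.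
-/

namespace Summit.CriticalPhenomena.PercolationContinuityZ3.Theorems.ThreePartition

open Finset Function
open scoped Classical

noncomputable section

variable {ι : Type*} [Fintype ι]

/-! ## The decoupled conjecture under disjoint supports -/

/-- **The rows are self-sufficient under disjoint supports**: if `𝒲` depends only on the coordinates in `J` and `𝒱` only on those
outside `J`, then on every row-closed family (`{b : (a,b) ∈ 𝒳}` an up-set for each `a`) the negative row units are outnumbered by the
positive ones, `T3⁻(𝒳) ≤ T3⁺(𝒳)` — the row move `triT_row_le_of_measurable` of `…VOrderDisjointSupports` with the common count
`#(c∈𝒱𝒲, b∈𝒲)` removed from both sides. [this work] -/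
theorem rowNegUnits_le_rowPosUnits_of_measurable (τ : Set ι) {𝒱 𝒲 : Set (Set ι)} {𝒳 : Set (Set ι × Set ι)}
    (h𝒲 : IsUpperSet 𝒲) (h𝒳 : ∀ a : Set ι, IsUpperSet {b : Set ι | (a, b) ∈ 𝒳}) (J : Set ι)
    (h𝒲J : ∀ w : Set ι, w ∈ 𝒲 ↔ w ∩ J ∈ 𝒲) (h𝒱J : ∀ w : Set ι, w ∈ 𝒱 ↔ w \ J ∈ 𝒱) :
    rowNegUnits τ 𝒱 𝒲 𝒳 ≤ rowPosUnits τ 𝒱 𝒲 𝒳 := by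
  have m3 := triT_row_le_of_measurable τ (fun a => {b : Set ι | (a, b) ∈ 𝒳}) h𝒳 h𝒲 J h𝒲J h𝒱J
  have m3' : triT τ (fun a b c => (a, b) ∈ 𝒳 ∧ c ∈ 𝒱 ∧ c ∈ 𝒲) ≤ triT τ (fun a b c => (a, b) ∈ 𝒳 ∧ c ∈ 𝒱 ∧ b ∈ 𝒲) := by
    refine le_trans (le_of_eq (triT_congr fun a b c => ?_)) (le_trans m3 (le_of_eq (triT_congr fun a b c => ?_)))
    · simp only [Set.mem_setOf_eq]
    · simp only [Set.mem_setOf_eq]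
  have s1 := triT_and_add_triT_and_not τ (fun a b c => (a, b) ∈ 𝒳 ∧ c ∈ 𝒱 ∧ c ∈ 𝒲) (fun _ b _ => b ∈ 𝒲)
  have s2 := triT_and_add_triT_and_not τ (fun a b c => (a, b) ∈ 𝒳 ∧ c ∈ 𝒱 ∧ b ∈ 𝒲) (fun _ _ c => c ∈ 𝒲)
  have e12 : triT τ (fun a b c => ((a, b) ∈ 𝒳 ∧ c ∈ 𝒱 ∧ c ∈ 𝒲) ∧ b ∈ 𝒲) =
      triT τ (fun a b c => ((a, b) ∈ 𝒳 ∧ c ∈ 𝒱 ∧ b ∈ 𝒲) ∧ c ∈ 𝒲) := triT_congr fun a b c => by tauto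
  have e1' : triT τ (fun a b c => ((a, b) ∈ 𝒳 ∧ c ∈ 𝒱 ∧ c ∈ 𝒲) ∧ ¬ b ∈ 𝒲) = rowNegUnits τ 𝒱 𝒲 𝒳 := by
    unfold rowNegUnits; exact triT_congr fun a b c => by tauto
  have e2' : triT τ (fun a b c => ((a, b) ∈ 𝒳 ∧ c ∈ 𝒱 ∧ b ∈ 𝒲) ∧ ¬ c ∈ 𝒲) = rowPosUnits τ 𝒱 𝒲 𝒳 := by
    unfold rowPosUnits; exact triT_congr fun a b c => by tauto
  rw [e12, e1'] at s1
  rw [e2'] at s2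
  omega

/-- **`DecoupledVOrder` holds when the supports are disjoint**: columns are self-sufficient always (`colNegUnits_le_colPosUnits`) and rows
are self-sufficient under disjoint supports (`rowNegUnits_le_rowPosUnits_of_measurable`); together with the nested cases the decoupled
conjecture is thus proved at both ends of the programme (the tight regime `Σκ = 0` and the nested regime `X = ∅`). [this work] -/
theorem decoupledVOrder_of_disjointSupports (τ : Set ι) {𝒱 𝒲 : Set (Set ι)} {𝒳 𝒰 : Set (Set ι × Set ι)}
    (h𝒱 : IsUpperSet 𝒱) (h𝒲 : IsUpperSet 𝒲) (h𝒳 : IsUpperSet 𝒳) (h𝒰 : ∀ b : Set ι, IsUpperSet {a : Set ι | (a, b) ∈ 𝒰})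
    (J : Set ι) (h𝒲J : ∀ w : Set ι, w ∈ 𝒲 ↔ w ∩ J ∈ 𝒲) (h𝒱J : ∀ w : Set ι, w ∈ 𝒱 ↔ w \ J ∈ 𝒱) :
    rowNegUnits τ 𝒱 𝒲 𝒳 + colNegUnits τ 𝒱 𝒲 𝒰 ≤ posUnits τ 𝒱 𝒲 (𝒳 ∪ 𝒰) := by
  have hB : ∀ a : Set ι, IsUpperSet {b : Set ι | (a, b) ∈ 𝒳} :=
    fun a b b' hle hb => h𝒳 (Prod.mk_le_mk.2 ⟨le_rfl, hle⟩) hb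
  have r := rowNegUnits_le_rowPosUnits_of_measurable τ h𝒲 hB J h𝒲J h𝒱J
  have c := colNegUnits_le_colPosUnits τ h𝒱 h𝒲 h𝒰
  have pr : rowPosUnits τ 𝒱 𝒲 𝒳 ≤ rowPosUnits τ 𝒱 𝒲 (𝒳 ∪ 𝒰) := by
    unfold rowPosUnits; exact triT_mono τ fun a b c hp => ⟨Set.mem_union_left _ hp.1, hp.2⟩
  have pc : colPosUnits τ 𝒱 𝒲 𝒰 ≤ colPosUnits τ 𝒱 𝒲 (𝒳 ∪ 𝒰) := by
    unfold colPosUnits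
    exact Nat.add_le_add (triT_mono τ fun a b c hp => ⟨Set.mem_union_right _ hp.1, hp.2⟩)
      (triT_mono τ fun a b c hp => ⟨Set.mem_union_right _ hp.1, hp.2⟩)
  unfold posUnits
  omega

end

end Summit.CriticalPhenomena.PercolationContinuityZ3.Theorems.ThreePartition
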